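import Summits.AtomisticToContinuum.FouriersLaw.Theorems.PhononMeanFreePathCoherentDephasingKickDuhamel
import Summits.AtomisticToContinuum.FouriersLaw.Theorems.BondHeatUncertaintyLightConeBondHeatGibbsByParts

/-!
# `CoherentDephasing` / line `Sketch` (strict absorption): Dynkin's identity for the polynomial class

Support file for stub `sa_polyDynkin` (sub-goal K2) of the lead's `N`-uniform strict-absorption skeleton for crux
`stmt-AtomisticToContinuum-11810` (`PhononMeanFreePath.CoherentDephasing`). For the `n`-site pinned anharmonic chain
`P = pinnedChain ω₂ lam β γ` (`ω₂, lam, β, γ > 0`) with both Langevin baths at `T > 0` and the CONSTRUCTED kernels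
`K_t = P.transitionKernel n T T t`, Dynkin's identity

  `K_r e(z) - e(z) = ∫₀ʳ K_s (L e)(z) ds`     (`r ≥ 0`, all `z`)

for every `C²` observable `e` of POLYNOMIAL energy growth: `|e| ≤ C_e (1+H)^k`, bath-momentum derivatives
`|∂_{p₀} e|, |∂_{p_{n-1}} e| ≤ D (1+H)^k`, and generator image `L e = ℓ` with `|ℓ| ≤ B (1+H)^k`. This generalises
`pinnedChain_dynkin_of_linearGrowth` (`…CoherentDephasingKickDuhamel`, the case `k = 1` with bounded derivatives) by
the same scheme: truncate `f_R = e χ(H/R)` (`χ = smoothCutoff`, `C²_c`), control the truncation error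
`|L(e χ_R) - χ_R L e| ≤ (A/R)(1+H)^{k+1}` (`generator_mul_smoothCutoff_hamiltonian`), dominate
`(1+H)^{k+1} ≤ C e^{H/(2T)}` (`one_add_pow_le_exp`) and conclude by `pinnedChain_dynkin_of_truncation` (dominated
convergence through CEHR (3.4)). Nothing here closes an item.
-/

noncomputable section

open MeasureTheory ProbabilityTheory Filter Topology Set
open scoped NNReal ENNReal

namespace Summit.AtomisticToContinuum.FouriersLaw.Theorems.CoherentDephasing.StrictAbsorption

open Literature.MathematicalPhysics.KineticTheory.HeatConduction
open Literature.MathematicalPhysics.KineticTheory Literature.Probability.Process OscillatorChain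
open Summit.AtomisticToContinuum.FouriersLaw.Theorems.SubdiffusiveBondHeat
open Summit.AtomisticToContinuum.FouriersLaw.Theorems.PhononMeanFreePath
open Summit.AtomisticToContinuum.FouriersLaw.Theorems.LightConeBondHeat

/-! ### The truncation error `L(e χ_R) - χ_R L e` for an observable of polynomial energy growth -/

section TruncError

variable {ω₂ lam β γ : ℝ}

/-- **Truncation error, polynomial class.** For the pinned chain (`ω₂, lam, β, γ ≥ 0`, `n ≥ 1` sites, equal bath
temperatures `T ≥ 0`), a `C²` observable `e` with `|e| ≤ C_e (1+H)^k` and `|∂_{p₀} e|, |∂_{p_{n-1}} e| ≤ D (1+H)^k`,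
there is `A ≥ 0` with `|L(e χ(H/R)) - χ(H/R) L e| ≤ (A/R)(1+H)^{k+1}` for all `R ≥ 1` (`χ = smoothCutoff`): by
`generator_mul_smoothCutoff_hamiltonian` the difference is `e Lχ_R + Γ(e, χ_R)`, every term of which carries a factor
`γ/R`, a factor `(1+H)^k` from `e` or `∂_{p_b} e`, and one factor `(1+H)` (`|χ'|, |χ''|` bounded, `p_b² ≤ 2H`,
`|p_b| ≤ 1 + H`). [folklore] -/
theorem polyDynkin_abs_generator_trunc_sub_le (hω : 0 ≤ ω₂) (hl : 0 ≤ lam) (hβ : 0 ≤ β) (hγ : 0 ≤ γ)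
    {n : ℕ} (hn : 0 < n) {T : ℝ} (hT : 0 ≤ T) (k : ℕ) {e : PhaseSpace n → ℝ} (he : ContDiff ℝ 2 e)
    {Ce D : ℝ} (hCe : 0 ≤ Ce) (hD : 0 ≤ D)
    (heb : ∀ y, |e y| ≤ Ce * (1 + (pinnedChain ω₂ lam β γ).hamiltonian n y) ^ k)
    (hd0 : ∀ y, |partialP ⟨0, hn⟩ e y| ≤ D * (1 + (pinnedChain ω₂ lam β γ).hamiltonian n y) ^ k)
    (hdN : ∀ y, |partialP ⟨n - 1, Nat.sub_lt hn one_pos⟩ e y| ≤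
      D * (1 + (pinnedChain ω₂ lam β γ).hamiltonian n y) ^ k) :
    ∃ A : ℝ, 0 ≤ A ∧ ∀ R : ℝ, 1 ≤ R → ∀ x : PhaseSpace n,
      |(pinnedChain ω₂ lam β γ).generator n T T
            (fun y => e y * smoothCutoff ((pinnedChain ω₂ lam β γ).hamiltonian n y / R)) x -
          smoothCutoff ((pinnedChain ω₂ lam β γ).hamiltonian n x / R) *
            (pinnedChain ω₂ lam β γ).generator n T T e x| ≤
        A / R * (1 + (pinnedChain ω₂ lam β γ).hamiltonian n x) ^ (k + 1) := by
  -- adapted from `MeanFieldDuhamel.pinnedChain_abs_generator_trunc_sub_le` (exponent `1 → k`)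
  obtain ⟨M₁, hM₁0, hM₁⟩ := exists_bound_deriv_smoothCutoff
  obtain ⟨M₂, hM₂0, hM₂⟩ := exists_bound_deriv_deriv_smoothCutoff
  refine ⟨γ * (Ce * (M₁ * (2 * T + 4) + 4 * M₂ * T) + 4 * M₁ * T * D), by positivity, fun R hR x => ?_⟩
  have hR0 : 0 < R := lt_of_lt_of_le one_pos hR
  have hTγ : 0 ≤ (pinnedChain ω₂ lam β γ).γ * T := mul_nonneg hγ hT
  have hU2 : ContDiff ℝ 2 (pinnedChain ω₂ lam β γ).U := pinnedChain_contDiff_U ω₂ lam β γ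
  have hV2 : ContDiff ℝ 2 (pinnedChain ω₂ lam β γ).V := pinnedChain_contDiff_V ω₂ lam β γ
  have hγ' : (pinnedChain ω₂ lam β γ).γ = γ := rfl
  rw [generator_mul_smoothCutoff_hamiltonian hU2 hV2 hn hTγ hTγ he R x, hγ', add_sub_cancel_left]
  -- elementary bounds
  have hH0 : 0 ≤ (pinnedChain ω₂ lam β γ).hamiltonian n x := pinnedChain_hamiltonian_nonneg hω hl hβ γ n x
  have hU0 : ∀ q, 0 ≤ (pinnedChain ω₂ lam β γ).U q := fun q => by
    show 0 ≤ ω₂ * q ^ 2 / 2 + lam * q ^ 4 / 4; positivity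
  have hV0 : ∀ r, 0 ≤ (pinnedChain ω₂ lam β γ).V r := fun r => by
    show 0 ≤ r ^ 2 / 2 + β * r ^ 4 / 4; positivity
  have hp2 : ∀ i : Fin n, x.2 i ^ 2 ≤ 2 * (pinnedChain ω₂ lam β γ).hamiltonian n x := fun i => by
    have h1 := (pinnedChain ω₂ lam β γ).site_le_hamiltonian hU0 hV0 n x i
    have h2 := hU0 (x.1 i)
    linarith
  have hpa : ∀ i : Fin n, |x.2 i| ≤ 1 + (pinnedChain ω₂ lam β γ).hamiltonian n x := fun i => by
    have h1 := abs_le_half_one_add_sq (x.2 i)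
    have h2 := hp2 i
    linarith
  have hE := heb x
  have ha := hd0 x
  have hb := hdN x
  have hpp := hp2 ⟨0, hn⟩
  have hqq := hp2 ⟨n - 1, Nat.sub_lt hn one_pos⟩
  have hpa' := hpa ⟨0, hn⟩
  have hqa' := hpa ⟨n - 1, Nat.sub_lt hn one_pos⟩
  have hχ₁b := hM₁ ((pinnedChain ω₂ lam β γ).hamiltonian n x / R)
  have hχ₂b := hM₂ ((pinnedChain ω₂ lam β γ).hamiltonian n x / R)
  -- make the atoms opaque
  generalize deriv smoothCutoff ((pinnedChain ω₂ lam β γ).hamiltonian n x / R) = χ₁ at hχ₁b ⊢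
  generalize deriv (deriv smoothCutoff) ((pinnedChain ω₂ lam β γ).hamiltonian n x / R) = χ₂ at hχ₂b ⊢
  generalize e x = E at hE ⊢
  generalize partialP ⟨0, hn⟩ e x = a at ha ⊢
  generalize partialP ⟨n - 1, Nat.sub_lt hn one_pos⟩ e x = b at hb ⊢
  generalize (pinnedChain ω₂ lam β γ).hamiltonian n x = Hx at hH0 hE ha hb hpp hqq hpa' hqa' ⊢
  generalize x.2 ⟨0, hn⟩ = p at hpp hpa' ⊢
  generalize x.2 ⟨n - 1, Nat.sub_lt hn one_pos⟩ = q at hqq hqa' ⊢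
  rw [pow_succ (1 + Hx) k]
  have hW0 : 0 ≤ (1 + Hx) ^ k := by positivity
  generalize (1 + Hx) ^ k = W at hE ha hb hW0 ⊢
  -- real arithmetic: everything carries a factor `γ/R`
  have key : E * (γ * (χ₁ / R * (T + T - p ^ 2 - q ^ 2) + χ₂ / R ^ 2 * (T * p ^ 2 + T * q ^ 2))) +
      χ₁ / R * (2 * γ * T * p * a + 2 * γ * T * q * b) =
      γ / R * (E * (χ₁ * (2 * T - p ^ 2 - q ^ 2) + χ₂ * T * (p ^ 2 + q ^ 2) / R) +
        χ₁ * (2 * T) * (p * a + q * b)) := by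
    field_simp; ring
  have h1 : |χ₁ * (2 * T - p ^ 2 - q ^ 2)| ≤ M₁ * (2 * T + p ^ 2 + q ^ 2) := by
    rw [abs_mul]
    refine mul_le_mul hχ₁b ?_ (abs_nonneg _) hM₁0
    have := sq_nonneg p
    have := sq_nonneg q
    rw [abs_le]; constructor <;> linarith
  have h2 : |χ₂ * T * (p ^ 2 + q ^ 2) / R| ≤ M₂ * T * (p ^ 2 + q ^ 2) := by
    have hb0 : 0 ≤ p ^ 2 + q ^ 2 := by positivity
    rw [abs_div, abs_mul, abs_mul, abs_of_nonneg hT, abs_of_nonneg hb0, abs_of_pos hR0]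
    calc |χ₂| * T * (p ^ 2 + q ^ 2) / R ≤ |χ₂| * T * (p ^ 2 + q ^ 2) / 1 :=
          div_le_div_of_nonneg_left (by positivity) one_pos hR
      _ ≤ M₂ * T * (p ^ 2 + q ^ 2) := by
          rw [div_one]
          exact mul_le_mul_of_nonneg_right (mul_le_mul_of_nonneg_right hχ₂b hT) hb0
  have h3 : |χ₁ * (2 * T) * (p * a + q * b)| ≤
      M₁ * (2 * T) * ((1 + Hx) * (D * W) + (1 + Hx) * (D * W)) := by
    rw [abs_mul, abs_mul, abs_of_nonneg (by positivity : (0:ℝ) ≤ 2 * T)]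
    have hpq : |p * a + q * b| ≤ (1 + Hx) * (D * W) + (1 + Hx) * (D * W) := by
      calc |p * a + q * b| ≤ |p * a| + |q * b| := abs_add_le _ _
        _ = |p| * |a| + |q| * |b| := by rw [abs_mul, abs_mul]
        _ ≤ (1 + Hx) * (D * W) + (1 + Hx) * (D * W) :=
            add_le_add (mul_le_mul hpa' ha (abs_nonneg _) (by positivity))
              (mul_le_mul hqa' hb (abs_nonneg _) (by positivity))
    exact mul_le_mul (mul_le_mul_of_nonneg_right hχ₁b (by positivity)) hpq (abs_nonneg _) (by positivity)
  have hin : |E * (χ₁ * (2 * T - p ^ 2 - q ^ 2) + χ₂ * T * (p ^ 2 + q ^ 2) / R) +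
      χ₁ * (2 * T) * (p * a + q * b)| ≤
      |E| * (M₁ * (2 * T + p ^ 2 + q ^ 2) + M₂ * T * (p ^ 2 + q ^ 2)) +
        M₁ * (2 * T) * ((1 + Hx) * (D * W) + (1 + Hx) * (D * W)) := by
    calc _ ≤ |E * (χ₁ * (2 * T - p ^ 2 - q ^ 2) + χ₂ * T * (p ^ 2 + q ^ 2) / R)| +
          |χ₁ * (2 * T) * (p * a + q * b)| := abs_add_le _ _
      _ = |E| * |χ₁ * (2 * T - p ^ 2 - q ^ 2) + χ₂ * T * (p ^ 2 + q ^ 2) / R| +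
          |χ₁ * (2 * T) * (p * a + q * b)| := by rw [abs_mul]
      _ ≤ |E| * (|χ₁ * (2 * T - p ^ 2 - q ^ 2)| + |χ₂ * T * (p ^ 2 + q ^ 2) / R|) +
          |χ₁ * (2 * T) * (p * a + q * b)| := by
          gcongr
          exact abs_add_le _ _
      _ ≤ _ := by gcongr
  have hE' : |E| ≤ Ce * W := hE
  have hpoly : |E| * (M₁ * (2 * T + p ^ 2 + q ^ 2) + M₂ * T * (p ^ 2 + q ^ 2)) +
      M₁ * (2 * T) * ((1 + Hx) * (D * W) + (1 + Hx) * (D * W)) ≤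
      (Ce * (M₁ * (2 * T + 4) + 4 * M₂ * T) + 4 * M₁ * T * D) * (W * (1 + Hx)) := by
    have hMT : 0 ≤ M₂ * T := mul_nonneg hM₂0 hT
    have hpq4 : p ^ 2 + q ^ 2 ≤ 4 * Hx := by linarith
    have s1 : M₁ * (2 * T + p ^ 2 + q ^ 2) + M₂ * T * (p ^ 2 + q ^ 2) ≤
        (M₁ * (2 * T + 4) + 4 * M₂ * T) * (1 + Hx) := by
      have a1 : M₁ * (p ^ 2 + q ^ 2) ≤ M₁ * (4 * Hx) := mul_le_mul_of_nonneg_left hpq4 hM₁0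
      have a2 : M₂ * T * (p ^ 2 + q ^ 2) ≤ M₂ * T * (4 * Hx) := mul_le_mul_of_nonneg_left hpq4 hMT
      have a3 : 0 ≤ M₁ * T * Hx := by positivity
      linarith
    have s2 : |E| * (M₁ * (2 * T + p ^ 2 + q ^ 2) + M₂ * T * (p ^ 2 + q ^ 2)) ≤
        (Ce * W) * ((M₁ * (2 * T + 4) + 4 * M₂ * T) * (1 + Hx)) :=
      mul_le_mul hE' s1 (by positivity) (by positivity)
    have e2 : (Ce * W) * ((M₁ * (2 * T + 4) + 4 * M₂ * T) * (1 + Hx)) =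
        Ce * (M₁ * (2 * T + 4) + 4 * M₂ * T) * (W * (1 + Hx)) := by ring
    have s3 : M₁ * (2 * T) * ((1 + Hx) * (D * W) + (1 + Hx) * (D * W)) =
        4 * M₁ * T * D * (W * (1 + Hx)) := by ring
    linarith
  rw [key, abs_mul, abs_div, abs_of_nonneg hγ, abs_of_pos hR0]
  calc γ / R * |E * (χ₁ * (2 * T - p ^ 2 - q ^ 2) + χ₂ * T * (p ^ 2 + q ^ 2) / R) +
        χ₁ * (2 * T) * (p * a + q * b)|
      ≤ γ / R * (|E| * (M₁ * (2 * T + p ^ 2 + q ^ 2) + M₂ * T * (p ^ 2 + q ^ 2)) +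
          M₁ * (2 * T) * ((1 + Hx) * (D * W) + (1 + Hx) * (D * W))) :=
        mul_le_mul_of_nonneg_left hin (div_nonneg hγ hR0.le)
    _ ≤ γ / R * ((Ce * (M₁ * (2 * T + 4) + 4 * M₂ * T) + 4 * M₁ * T * D) * (W * (1 + Hx))) :=
        mul_le_mul_of_nonneg_left hpoly (div_nonneg hγ hR0.le)
    _ = γ * (Ce * (M₁ * (2 * T + 4) + 4 * M₂ * T) + 4 * M₁ * T * D) / R * (W * (1 + Hx)) := by ring

end TruncError

/-! ### Dynkin's identity for an observable of polynomial energy growth -/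

section Dynkin

variable {ω₂ lam β γ : ℝ} (hω : 0 < ω₂) (hl : 0 ≤ lam) (hβ : 0 < β) (hγ : 0 < γ) {n : ℕ} (hn : 0 < n)
  {T : ℝ} (hT : 0 < T)
include hω hl hβ hγ hn hT

/-- **Dynkin's identity for an observable of polynomial energy growth.** For the pinned chain (`ω₂, β, γ > 0`,
`lam ≥ 0`, `n ≥ 1`, equal bath temperatures `T > 0`), a `C²` observable `e` with `|e| ≤ C_e(1+H)^k`,
`|∂_{p₀} e|, |∂_{p_{n-1}} e| ≤ D(1+H)^k` and generator image `L e = ℓ` with `|ℓ| ≤ B(1+H)^k`: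
`P_r e(z) - e(z) = ∫₀ʳ P_s ℓ(z) ds` for the constructed transition kernels, all `r ≥ 0`, `z`. Proof: the
truncations `e χ(H/(m+1))` are `C²_c`, converge to `e` with generators converging to `ℓ`
(`polyDynkin_abs_generator_trunc_sub_le`), all dominated by `K e^{H/(2T)}` (`one_add_pow_le_exp`); conclude by
`pinnedChain_dynkin_of_truncation` (dominated convergence through CEHR (3.4)).
[cite: CuneoEckmannHairerReyBellet2018, §3 eq. (3.2)–(3.4)] -/
theorem polyDynkin_dynkin_of_polyGrowth (k : ℕ) {e ℓ : PhaseSpace n → ℝ} (he : ContDiff ℝ 2 e)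
    (hgen : ∀ x, (pinnedChain ω₂ lam β γ).generator n T T e x = ℓ x) {Ce D B : ℝ} (hCe : 0 ≤ Ce)
    (hD : 0 ≤ D) (hB : 0 ≤ B) (heb : ∀ y, |e y| ≤ Ce * (1 + (pinnedChain ω₂ lam β γ).hamiltonian n y) ^ k)
    (hd0 : ∀ y, |partialP ⟨0, hn⟩ e y| ≤ D * (1 + (pinnedChain ω₂ lam β γ).hamiltonian n y) ^ k)
    (hdN : ∀ y, |partialP ⟨n - 1, Nat.sub_lt hn one_pos⟩ e y| ≤
      D * (1 + (pinnedChain ω₂ lam β γ).hamiltonian n y) ^ k)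
    (hℓb : ∀ y, |ℓ y| ≤ B * (1 + (pinnedChain ω₂ lam β γ).hamiltonian n y) ^ k)
    (r : ℝ≥0) (z : PhaseSpace n) :
    ∫ y, e y ∂((pinnedChain ω₂ lam β γ).transitionKernel n T T r z) - e z =
      ∫ s in (0 : ℝ)..(r : ℝ), ∫ y, ℓ y ∂((pinnedChain ω₂ lam β γ).transitionKernel n T T s.toNNReal z) := by
  -- adapted from `MeanFieldDuhamel.pinnedChain_dynkin_of_linearGrowth` (weight `(1+H)² → (1+H)^{k+1}`)
  obtain ⟨A, hA0, hA⟩ := polyDynkin_abs_generator_trunc_sub_le hω.le hl hβ.le hγ.le hn hT.le k he hCe hD heb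
    hd0 hdN
  set θ : ℝ := 1 / (2 * T) with hθ
  have hθ0 : 0 < θ := by positivity
  have hθ1 : θ < 1 / T := by
    rw [hθ, div_lt_div_iff₀ (by positivity) hT]; nlinarith
  set C₀ : ℝ := (k + 1).factorial * Real.exp θ / θ ^ (k + 1) with hC₀
  have hC₀0 : 0 ≤ C₀ := by positivity
  -- the truncations
  set f : ℕ → PhaseSpace n → ℝ := fun m y =>
    e y * smoothCutoff ((pinnedChain ω₂ lam β γ).hamiltonian n y / (m + 1)) with hf
  have hfdef : ∀ m y, f m y = e y * smoothCutoff ((pinnedChain ω₂ lam β γ).hamiltonian n y / (m + 1)) :=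
    fun m y => rfl
  have hU2 : ContDiff ℝ 2 (pinnedChain ω₂ lam β γ).U := pinnedChain_contDiff_U ω₂ lam β γ
  have hV2 : ContDiff ℝ 2 (pinnedChain ω₂ lam β γ).V := pinnedChain_contDiff_V ω₂ lam β γ
  have hH2 : ContDiff ℝ 2 ((pinnedChain ω₂ lam β γ).hamiltonian n) :=
    (pinnedChain ω₂ lam β γ).contDiff_hamiltonian hU2 hV2 n
  have hH0 : ∀ y, 0 ≤ (pinnedChain ω₂ lam β γ).hamiltonian n y := fun y =>
    pinnedChain_hamiltonian_nonneg hω.le hl hβ.le γ n y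
  have hRpos : ∀ m : ℕ, (0:ℝ) < m + 1 := fun m => by positivity
  have hR1 : ∀ m : ℕ, (1:ℝ) ≤ m + 1 := fun m => by
    have : (0:ℝ) ≤ m := Nat.cast_nonneg m
    linarith
  have hf2 : ∀ m, ContDiff ℝ 2 (f m) := fun m =>
    he.mul ((contDiff_smoothCutoff (n := 2)).comp (hH2.div_const _))
  have hfs : ∀ m, HasCompactSupport (f m) := fun m => by
    refine HasCompactSupport.intro
      (pinnedChain_isCompact_setOf_hamiltonian_le hω hl hβ.le γ n (2 * (m + 1))) fun y hy => ?_
    simp only [mem_setOf_eq, not_le] at hy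
    have h2 : 2 ≤ (pinnedChain ω₂ lam β γ).hamiltonian n y / (m + 1) := by
      rw [le_div_iff₀ (hRpos m)]; linarith
    rw [hfdef, smoothCutoff_of_two_le h2, mul_zero]
  -- eventually the cutoff is `1`
  have hev : ∀ y, ∀ᶠ m : ℕ in atTop, smoothCutoff ((pinnedChain ω₂ lam β γ).hamiltonian n y / (m + 1)) = 1 := by
    intro y
    obtain ⟨m₀, hm₀⟩ := exists_nat_ge ((pinnedChain ω₂ lam β γ).hamiltonian n y)
    filter_upwards [eventually_ge_atTop m₀] with m hm
    have h1 : (pinnedChain ω₂ lam β γ).hamiltonian n y / (m + 1) ≤ 1 := by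
      rw [div_le_one (hRpos m)]
      have : (m₀ : ℝ) ≤ m := by exact_mod_cast hm
      linarith
    exact smoothCutoff_of_le_one h1
  -- size estimates
  have hsq : ∀ y, (1 + (pinnedChain ω₂ lam β γ).hamiltonian n y) ^ (k + 1) ≤
      C₀ * Real.exp (θ * (pinnedChain ω₂ lam β γ).hamiltonian n y) := fun y =>
    one_add_pow_le_exp (k + 1) (hH0 y) hθ0
  have hpow : ∀ y, (1 + (pinnedChain ω₂ lam β γ).hamiltonian n y) ^ k ≤
      (1 + (pinnedChain ω₂ lam β γ).hamiltonian n y) ^ (k + 1) := fun y =>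
    pow_le_pow_right₀ (by linarith [hH0 y]) (Nat.le_succ k)
  have he1 : ∀ y, |e y| ≤ Ce * (1 + (pinnedChain ω₂ lam β γ).hamiltonian n y) ^ (k + 1) := fun y =>
    (heb y).trans (mul_le_mul_of_nonneg_left (hpow y) hCe)
  have hℓ1 : ∀ y, |ℓ y| ≤ B * (1 + (pinnedChain ω₂ lam β γ).hamiltonian n y) ^ (k + 1) := fun y =>
    (hℓb y).trans (mul_le_mul_of_nonneg_left (hpow y) hB)
  -- the truncation error, with `Le = ℓ`
  have herr : ∀ (m : ℕ) (y : PhaseSpace n),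
      |(pinnedChain ω₂ lam β γ).generator n T T (f m) y -
          smoothCutoff ((pinnedChain ω₂ lam β γ).hamiltonian n y / (m + 1)) * ℓ y| ≤
        A / (m + 1) * (1 + (pinnedChain ω₂ lam β γ).hamiltonian n y) ^ (k + 1) := by
    intro m y
    have h := hA (m + 1) (hR1 m) y
    rw [hgen y] at h
    exact h
  -- the uniform exponential domination of `f_m` and `L f_m`
  have hfb : ∀ (m : ℕ) (y : PhaseSpace n),
      |f m y| ≤ (A + B + Ce) * C₀ * Real.exp (θ * (pinnedChain ω₂ lam β γ).hamiltonian n y) := by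
    intro m y
    have h1 := he1 y
    have hHy := hH0 y
    have hχ0 := smoothCutoff_nonneg ((pinnedChain ω₂ lam β γ).hamiltonian n y / (m + 1))
    have hχ1 := smoothCutoff_le_one ((pinnedChain ω₂ lam β γ).hamiltonian n y / (m + 1))
    have hs := hsq y
    rw [hfdef, abs_mul, abs_of_nonneg hχ0]
    generalize (pinnedChain ω₂ lam β γ).hamiltonian n y = Hy at h1 hs hHy hχ0 hχ1 ⊢
    generalize smoothCutoff (Hy / (m + 1)) = c at hχ0 hχ1 ⊢
    calc |e y| * c ≤ |e y| := mul_le_of_le_one_right (abs_nonneg _) hχ1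
      _ ≤ Ce * (1 + Hy) ^ (k + 1) := h1
      _ ≤ (A + B + Ce) * (1 + Hy) ^ (k + 1) := by gcongr; linarith
      _ ≤ (A + B + Ce) * (C₀ * Real.exp (θ * Hy)) := by gcongr
      _ = (A + B + Ce) * C₀ * Real.exp (θ * Hy) := by ring
  have hLb : ∀ (m : ℕ) (y : PhaseSpace n), |(pinnedChain ω₂ lam β γ).generator n T T (f m) y| ≤
      (A + B + Ce) * C₀ * Real.exp (θ * (pinnedChain ω₂ lam β γ).hamiltonian n y) := by
    intro m y
    have h1 := herr m y
    have h2 := hℓ1 y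
    have hs := hsq y
    have hHy := hH0 y
    have hχ0 := smoothCutoff_nonneg ((pinnedChain ω₂ lam β γ).hamiltonian n y / (m + 1))
    have hχ1 := smoothCutoff_le_one ((pinnedChain ω₂ lam β γ).hamiltonian n y / (m + 1))
    generalize (pinnedChain ω₂ lam β γ).generator n T T (f m) y = G at h1 ⊢
    generalize (pinnedChain ω₂ lam β γ).hamiltonian n y = Hy at h1 h2 hs hHy hχ0 hχ1 ⊢
    generalize smoothCutoff (Hy / (m + 1)) = c at hχ0 hχ1 h1 ⊢
    generalize ℓ y = l at h1 h2 ⊢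
    have hX : 0 ≤ (1 + Hy) ^ (k + 1) := by positivity
    have h3 : |c * l| ≤ B * (1 + Hy) ^ (k + 1) := by
      rw [abs_mul, abs_of_nonneg hχ0]
      calc c * |l| ≤ 1 * |l| := mul_le_mul_of_nonneg_right hχ1 (abs_nonneg _)
        _ ≤ B * (1 + Hy) ^ (k + 1) := by rw [one_mul]; exact h2
    have h4 : A / (m + 1) * (1 + Hy) ^ (k + 1) ≤ A * (1 + Hy) ^ (k + 1) :=
      mul_le_mul_of_nonneg_right (div_le_self hA0 (hR1 m)) hX
    calc |G| ≤ |G - c * l| + |c * l| := by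
          have := abs_add_le (G - c * l) (c * l); rwa [sub_add_cancel] at this
      _ ≤ A * (1 + Hy) ^ (k + 1) + B * (1 + Hy) ^ (k + 1) := add_le_add (h1.trans h4) h3
      _ ≤ (A + B + Ce) * (1 + Hy) ^ (k + 1) := by nlinarith [mul_nonneg hCe hX]
      _ ≤ (A + B + Ce) * (C₀ * Real.exp (θ * Hy)) := by gcongr
      _ = (A + B + Ce) * C₀ * Real.exp (θ * Hy) := by ring
  -- pointwise convergence of `f_m` and `L f_m`
  have hfe : ∀ y, Tendsto (fun m => f m y) atTop (𝓝 (e y)) := fun y => by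
    refine tendsto_const_nhds.congr' ?_
    filter_upwards [hev y] with m hm
    rw [hfdef, hm, mul_one]
  have hfℓ : ∀ y, Tendsto (fun m => (pinnedChain ω₂ lam β γ).generator n T T (f m) y) atTop (𝓝 (ℓ y)) := by
    intro y
    have hg : Tendsto (fun m : ℕ => smoothCutoff ((pinnedChain ω₂ lam β γ).hamiltonian n y / (m + 1)) * ℓ y)
        atTop (𝓝 (ℓ y)) := by
      refine tendsto_const_nhds.congr' ?_
      filter_upwards [hev y] with m hm
      rw [hm, one_mul]
    have hd : Tendsto (fun m : ℕ => (pinnedChain ω₂ lam β γ).generator n T T (f m) y -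
        smoothCutoff ((pinnedChain ω₂ lam β γ).hamiltonian n y / (m + 1)) * ℓ y) atTop (𝓝 0) := by
      have hCn : Tendsto (fun m : ℕ => A / (m + 1) * (1 + (pinnedChain ω₂ lam β γ).hamiltonian n y) ^ (k + 1))
          atTop (𝓝 0) := by
        have h1 : Tendsto (fun m : ℕ => A / ((m : ℝ) + 1)) atTop (𝓝 0) :=
          tendsto_const_nhds.div_atTop (tendsto_natCast_atTop_atTop.atTop_add tendsto_const_nhds)
        simpa using h1.mul_const ((1 + (pinnedChain ω₂ lam β γ).hamiltonian n y) ^ (k + 1))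
      exact squeeze_zero_norm (fun m => by rw [Real.norm_eq_abs]; exact herr m y) hCn
    have := hd.add hg
    simpa using this
  exact pinnedChain_dynkin_of_truncation hω hl hβ hγ hn hT hθ0 hθ1 f hf2 hfs hfe hfℓ hfb hLb r z

end Dynkin

/-! ### The registered sub-goal K2 -/

/-- **SUB-GOAL K2 (Dynkin's identity for the polynomial class).** For the `n`-site pinned anharmonic chain
(`ω₂, lam, β, γ > 0`) with both baths at `T > 0` and the constructed kernels `K_t`: every `C²` observable `e` with
`|e| ≤ C_e (1+H)^k`, `|∂_{p₀} e|, |∂_{p_{n-1}} e| ≤ D (1+H)^k` and generator image `L e = ℓ`, `|ℓ| ≤ B (1+H)^k`,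
satisfies `K_r e(z) - e(z) = ∫₀ʳ K_s ℓ(z) ds` for all `r ≥ 0` and all `z` (`polyDynkin_dynkin_of_polyGrowth`;
generalises `pinnedChain_dynkin_of_linearGrowth`). [cite: CuneoEckmannHairerReyBellet2018, §3 eq. (3.2)–(3.4)] -/
theorem sa_polyDynkin :
    ∀ ω₂ lam β γ : ℝ, 0 < ω₂ → 0 < lam → 0 < β → 0 < γ → ∀ T : ℝ, 0 < T → ∀ (n k : ℕ) (hn : 0 < n) (e ℓ : PhaseSpace n → ℝ) (Ce D B : ℝ), ContDiff ℝ 2 e → (∀ x, (pinnedChain ω₂ lam β γ).generator n T T e x = ℓ x) → 0 ≤ Ce → 0 ≤ D → 0 ≤ B → (∀ y, |e y| ≤ Ce * (1 + (pinnedChain ω₂ lam β γ).hamiltonian n y) ^ k) → (∀ y, |partialP ⟨0, hn⟩ e y| ≤ D * (1 + (pinnedChain ω₂ lam β γ).hamiltonian n y) ^ k) → (∀ y, |partialP ⟨n - 1, Nat.sub_lt hn one_pos⟩ e y| ≤ D * (1 + (pinnedChain ω₂ lam β γ).hamiltonian n y) ^ k) → (∀ y, |ℓ y| ≤ B * (1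 + (pinnedChain ω₂ lam β γ).hamiltonian n y) ^ k) → ∀ (r : NNReal) (z : PhaseSpace n), ∫ y, e y ∂((pinnedChain ω₂ lam β γ).transitionKernel n T T r z) - e z = ∫ s in (0 : ℝ)..(r : ℝ), ∫ y, ℓ y ∂((pinnedChain ω₂ lam β γ).transitionKernel n T T s.toNNReal z) := by
  intro ω₂ lam β γ hω hl hβ hγ T hT n k hn e ℓ Ce D B he hgen hCe hD hB heb hd0 hdN hℓb r z
  exact polyDynkin_dynkin_of_polyGrowth hω hl.le hβ hγ hn hT k he hgen hCe hD hB heb hd0 hdN hℓb r z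

end Summit.AtomisticToContinuum.FouriersLaw.Theorems.CoherentDephasing.StrictAbsorption

end
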